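import Literature.NumberTheory.GaloisCohomology.Howard2004.DVRKolyvaginBound
import Literature.NumberTheory.GaloisCohomology.Howard2004.ConjugationDatumDihedralProofs
import Literature.NumberTheory.GaloisCohomology.Howard2004.ConjugationDatumInertiaProofs
import Literature.NumberTheory.GaloisCohomology.Howard2004.DegreeTwoInertProofs
import HarnessLib

/-!
# The conjugation-datum letters `hI`, `hφ`, `hφI`, `hφΛ` on a `DVRSetting` (S-level one-liners; proofs file)

Topic `NumberTheory/GaloisCohomology/Howard2004`.  THEOREMS ONLY: no definition, no named fact, no instance,
no notation, no `sorry`.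

B. Howard, *The Heegner point Kolyvagin system*, Compositio Math. **140** (2004) = arXiv:1202.6340, §1.3 (p. 7
L44–48: the transports «conjugation by `τ`») and §1.6 (Thm. 1.6.1 over the data `(R, T, F, 𝓛)` of a
`DVRSetting`).  The engine binder `h159` (`DVRSetting.stub_le_ker_locR_insert_of_stub_le_ker_locR`,
`DVRSettingEngineH159Proofs`, seat x9-p1-w4 g17) carries five DATUM letters about `S.cd` at the primes of
`S.L`: `hI`, `hφ`, `hφI`, `hφΛ`, `hδ`.  This file DISCHARGES the first four VERBATIM, for EVERY `DVRSetting`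
(general `S.cd : ConjugationDatum K`), from the datum-level theorems of `ConjugationDatumInertiaProofs`
(`hI`, `hφI` — [NSW] 12.1.3 + Neukirch II (9.6)), `RingClassConjugationStableProofs` (`hφ`, x10b-p1-w6 g9) and
`ConjugationDatumDihedralProofs` (`hφΛ` — Cox 9.3 dihedral half); `K` imaginary quadratic enters through
`hy.imagQuad`, the residue characteristic `residueChar v ≠ 0` through `prime_residueChar`:

* `DVRSetting.datum_hI` : `∀ v ∈ S.L, ∀ g ∈ I_{K_v}, S.cd.φ v g ∈ I_{K_{σv}}`;
* `DVRSetting.datum_hφ` : `∀ v ∈ S.L, ∀ h ∈ Λ_v, S.cd.φ v h ∈ Λ_{σv}` (`Λ_w = localRingClassSubgroup (residueChar v) S.jbar w`);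
* `DVRSetting.datum_hφI` : `∀ v (hv : σ • v = v), v ∈ S.L → ∀ g, ∃ i ∈ I_{K_v}, (hv ▸ φ_v g) = i * g`;
* `DVRSetting.datum_hφΛ` : `∀ v (hv : σ • v = v), v ∈ S.L → ∀ g, ∃ l ∈ Λ_v, (hv ▸ φ_v g) = l * g⁻¹`.
(The membership `v ∈ S.L` is not even used: all four hold at every finite place.)  The assembler plugs
`h159 := S.stub_le_ker_locR_insert_of_stub_le_ker_locR hy hdec hd hPT S.datum_hI (S.datum_hφ hy) S.datum_hφI
(S.datum_hφΛ hy) hδ hpar`.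

Cell `pub/bsd-print-x9`, G87 = Howard 2004 Thm. 1.6.1 (print leaf `stub_h161` of stmt-BirchSwinnertonDyer-22642);
seat `bsd-line-x10b-p1-w5` g9, brick (DATUM-GEN) S-level.  NOT HERE: `hδ` (the pairing letter), `hpar`, `hPT`,
`hd`; `thm161_dvrKolyvaginBound` is NOT proved; no summit statement is proved; BSD is not proved by any of this.

References: [Howard2004HeegnerKolyvagin] §1.3 (arXiv p. 7 L44–48), §1.6; [NeukirchSchmidtWingberg2008] Cor. 12.1.3;
[Cox2013] §9.A Lemma 9.3.
-/

set_option autoImplicit false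

noncomputable section

open scoped NumberField
open NumberField IsDedekindDomain Field

namespace Literature.NumberTheory.GaloisCohomology.Howard2004

open Literature.NumberTheory.GaloisRepresentations
open Literature.NumberTheory.EllipticCurves

namespace DVRSetting

variable {p : ℕ} [Fact p.Prime] {K : Type} [Field K] [NumberField K]
  {R : Type} [CommRing R] [IsDomain R] [IsDiscreteValuationRing R] [Algebra ℤ_[p] R]
  {N : ℕ → Type} [∀ k, AddCommGroup (N k)] [∀ k, TopologicalSpace (N k)]
  [∀ k, DiscreteTopology (N k)] [∀ k, Module R (N k)]
  {Rk : ℕ → Type} [∀ k, CommRing (Rk k)] [∀ k, IsLocalRing (Rk k)] [∀ k, TopologicalSpace (Rk k)]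
  [∀ k, DiscreteTopology (Rk k)] [∀ k, Algebra ℤ_[p] (Rk k)] [∀ k, Algebra R (Rk k)]
  [∀ k, Module (Rk k) (N k)] [∀ k, IsScalarTower R (Rk k) (N k)]
  {Nbar : Type} [AddCommGroup Nbar] [TopologicalSpace Nbar] [DiscreteTopology Nbar]
  [∀ k, Module (Rk k) Nbar]
  {Nq : ℕ → Finset (HeightOneSpectrum (𝓞 K)) → Type} [∀ k n, AddCommGroup (Nq k n)]
  [∀ k n, TopologicalSpace (Nq k n)] [∀ k n, DiscreteTopology (Nq k n)]
  [∀ k n, Module (Rk k) (Nq k n)] [∀ k n, Module R (Nq k n)]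
  [∀ k n, IsScalarTower R (Rk k) (Nq k n)]

/-- **The letter `hI` on a `DVRSetting`**: at every prime of `𝓛` (indeed at every finite place) the local transport
of `S.cd` maps inertia into inertia — VERBATIM the binder `hI` of
`DVRSetting.stub_le_ker_locR_insert_of_stub_le_ker_locR` (`ConjugationDatum.φ_mem_absInertia`).
[cite: Howard2004HeegnerKolyvagin, §1.3 (arXiv p. 7 L44–48) with Prop. 1.5.9 (p. 10)] [cite: NeukirchSchmidtWingberg2008, Cor. 12.1.3] -/
theorem datum_hI (S : DVRSetting p K R N Rk Nbar Nq) :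
    ∀ v ∈ S.L, ∀ g ∈ absInertia (v.adicCompletion K),
      S.cd.φ v g ∈ absInertia ((S.cd.σ • v).adicCompletion K) :=
  fun v _ _ hg => S.cd.φ_mem_absInertia v hg

/-- **The letter `hφ` on a `DVRSetting`** (`K` imaginary quadratic by `hy.imagQuad`): the local transport maps
`Γ_{K_v} ∩ Γ_{K[ℓ]}` into `Γ_{K_{σv}} ∩ Γ_{K[ℓ]}`, `ℓ = residueChar v` — VERBATIM the binder `hφ` of
`DVRSetting.stub_le_ker_locR_insert_of_stub_le_ker_locR` (x10b-p1-w6 g9's `ConjugationDatum.φ_mem_localRingClassSubgroup`).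
[cite: Howard2004HeegnerKolyvagin, §1.2–§1.3 (arXiv p. 6 L84–95, p. 7 L44–48)] [cite: Cox2013, §9.A Lemma 9.3] -/
theorem datum_hφ (S : DVRSetting p K R N Rk Nbar Nq) (hy : S.SatisfiesH) :
    ∀ v ∈ S.L, ∀ h ∈ localRingClassSubgroup (residueChar v) S.jbar v,
      S.cd.φ v h ∈ localRingClassSubgroup (residueChar v) S.jbar (S.cd.σ • v) :=
  fun v _ _ hh => S.cd.φ_mem_localRingClassSubgroup hy.imagQuad S.jbar (prime_residueChar v).ne_zero v hh

/-- **The letter `hφI` on a `DVRSetting`**: at a prime of `𝓛` fixed by `σ` the local transport is the identity modulo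
inertia — VERBATIM the binder `hφI` of `DVRSetting.stub_le_ker_locR_insert_of_stub_le_ker_locR`
(`ConjugationDatum.exists_mem_absInertia_φ_cast_eq`). [cite: Howard2004HeegnerKolyvagin, §1.3 (arXiv p. 7 L44–48) with Prop. 1.5.9 (p. 10)] [cite: NeukirchSchmidtWingberg2008, Cor. 12.1.3] -/
theorem datum_hφI (S : DVRSetting p K R N Rk Nbar Nq) :
    ∀ (v : HeightOneSpectrum (𝓞 K)) (hv : S.cd.σ • v = v), v ∈ S.L →
      ∀ g : absoluteGaloisGroup (v.adicCompletion K), ∃ i ∈ absInertia (v.adicCompletion K),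
        (hv ▸ S.cd.φ v g : absoluteGaloisGroup (v.adicCompletion K)) = i * g :=
  fun _ hv _ g => S.cd.exists_mem_absInertia_φ_cast_eq hv g

/-- **The letter `hφΛ` on a `DVRSetting`** (`K` imaginary quadratic by `hy.imagQuad`): at a prime of `𝓛` fixed by
`σ` the local transport inverts `Γ_{K_v}` modulo `Γ_{K_v} ∩ Γ_{K[ℓ]}` — VERBATIM the binder `hφΛ` of
`DVRSetting.stub_le_ker_locR_insert_of_stub_le_ker_locR` (`ConjugationDatum.exists_mem_localRingClassSubgroup_φ_cast_eq`).
[cite: Howard2004HeegnerKolyvagin, Lemma 1.5.3 proof (arXiv p. 10 L12–16) with §1.3 (p. 7 L44–48)] [cite: Cox2013, §9.A Lemma 9.3] -/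
theorem datum_hφΛ (S : DVRSetting p K R N Rk Nbar Nq) (hy : S.SatisfiesH) :
    ∀ (v : HeightOneSpectrum (𝓞 K)) (hv : S.cd.σ • v = v), v ∈ S.L →
      ∀ g : absoluteGaloisGroup (v.adicCompletion K),
        ∃ l ∈ localRingClassSubgroup (residueChar v) S.jbar v,
          (hv ▸ S.cd.φ v g : absoluteGaloisGroup (v.adicCompletion K)) = l * g⁻¹ :=
  fun v hv _ g =>
    S.cd.exists_mem_localRingClassSubgroup_φ_cast_eq hy.imagQuad hv S.jbar (prime_residueChar v).ne_zero g

/-- **The letter `hφγ` on a `DVRSetting`** (for the `hcheb` side: the Frobenius coset is preserved): at a prime fixed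
by `σ`, `g⁻¹ * (hv ▸ φ_v g) ∈ I_{K_v}` for every `g` — VERBATIM the binder `hφγ` of `InertEigenlinesProofs`
(`ConjugationDatum.inv_mul_φ_cast_mem_absInertia`). [cite: Howard2004HeegnerKolyvagin, Lemma 1.5.3 proof (arXiv p. 10 L12–16) with Prop. 1.1.7 (p. 5)] [cite: NeukirchSchmidtWingberg2008, Cor. 12.1.3] -/
theorem datum_hφγ (S : DVRSetting p K R N Rk Nbar Nq) {v : HeightOneSpectrum (𝓞 K)} (hv : S.cd.σ • v = v)
    (g : absoluteGaloisGroup (v.adicCompletion K)) :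
    g⁻¹ * (hv ▸ S.cd.φ v g : absoluteGaloisGroup (v.adicCompletion K)) ∈ absInertia (v.adicCompletion K) :=
  S.cd.inv_mul_φ_cast_mem_absInertia hv g

/-- **The letter `hdih` on a `DVRSetting`** (for the `hcheb` side): at a prime fixed by `σ`, `(hv ▸ φ_v g) * g ∈ Λ_v` for
every `g` and every `c ≠ 0` — VERBATIM the binder `hdih` of `InertEigenlinesProofs` (at `g := σ₀`, `c := ℓ`)
(`ConjugationDatum.φ_cast_mul_mem_localRingClassSubgroup`). [cite: Howard2004HeegnerKolyvagin, Lemma 1.5.3 proof (arXiv p. 10 L12–16)] [cite: Cox2013, §9.A Lemma 9.3] -/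
theorem datum_hdih (S : DVRSetting p K R N Rk Nbar Nq) (hy : S.SatisfiesH) {v : HeightOneSpectrum (𝓞 K)}
    (hv : S.cd.σ • v = v) {c : ℕ} (hc : c ≠ 0) (g : absoluteGaloisGroup (v.adicCompletion K)) :
    (hv ▸ S.cd.φ v g : absoluteGaloisGroup (v.adicCompletion K)) * g ∈ localRingClassSubgroup c S.jbar v :=
  S.cd.φ_cast_mul_mem_localRingClassSubgroup hy.imagQuad hv S.jbar hc g

end DVRSetting

end Literature.NumberTheory.GaloisCohomology.Howard2004

end
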